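import Mathlib
import Literature.Analysis.FluidPDE.FluidComputer.RotationalForm
import Literature.Analysis.FluidPDE.FluidComputer.ScaleByScaleBudget

/-!
# Grid characters, Bessel and Parseval on the `N³` grid — part B `LambGridBessel` of the Lamb-efficiency ledger
(pub-fluidc cell, rung R2, CARD O7 §5)

HONEST FRAMING (cell `pub-fluidc`, verbatim): *low prior, high value-of-information experiment on
Tao's machine paradigm; NOT a claim that NS blows up.*

Mathematics and Lean by seat idea-2 gen 6 (`HOME/pub-fluidc-idea-2/SKETCH-R2-lamb-galerkin.lean`, sha16
97789fb5c3bf72e2, 659 lines, CARD O7 §5); split into three tree files (≤ 400 lines each, one namespace,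
declaration names unchanged) and landed by seat p2 gen 2: `LambWork` (§§0–3: flux is Lamb work,
Cauchy–Schwarz efficiency ≤ 1, Frisch (2.48) with Lamb work), `LambGridBessel` (§4a: grid characters,
Bessel, Parseval — independent of `LambWork`), `LambCertified` (§4b–§5: Hermitian Lagrange identity, the
certified column `abs_shellTransfer_le_certified`, the clock corollary; imports both).

This file (§4a) is pure grid harmonic analysis over the tree's `ShellTransfer.Dealiasing` (`chi`, `coef`,
`synth`, `modN`, `box`): `conj_chi`, `sum_mul_chi_neg`, `sum_conj_chi_mul_chi` (orthogonality of grid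
characters), `modN_inj_of_box` (modes of the cubic mask `|k_i| ≤ K` are distinct mod `N` when `2K < N`),
**`grid_bessel`** (`N³ Σ_{k∈O} |ĝ(k)|² ≤ Σ_n |g(n)|²` for modes distinct mod `N`) and **`grid_parseval`**
(`Σ_n |synth a(n)|² = N³ Σ_{k∈B} |a_k|²`). No definitions; 0 sorry. Used by `LambCertified` to turn the
out-band Lamb energy into grid sums (the engines' `umax` / `wmax` are GRID maxima).
-/



open Complex ComplexConjugate Finset
open scoped BigOperators
open Literature.Analysis.FluidPDE.FluidComputer
open Literature.Analysis.FluidPDE.FluidComputer.ShellTransfer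

namespace Summit.NavierStokesRegularity.FluidComputer.LambCeiling.Galerkin

section Grid

open Literature.Analysis.FluidPDE.FluidComputer.ShellTransfer.Dealiasing AddChar ZMod

variable {N : ℕ} [NeZero N]

/-- `conj χ_m = χ_{-m}`. [folklore] -/
theorem conj_chi (m n : Fin 3 → ZMod N) : conj (chi m n) = chi (-m) n := by
  unfold chi
  have e : ∑ i, (-m) i * n i = -∑ i, m i * n i := by
    simp only [Pi.neg_apply, neg_mul, Finset.sum_neg_distrib]
  rw [e, map_neg_eq_inv]
  have h1 : ‖(stdAddChar (∑ i, m i * n i) : ℂ)‖ = 1 := by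
    rw [stdAddChar_apply]; exact Circle.norm_coe _
  rw [Complex.inv_eq_conj h1]

/-- `Σ_n g(n) χ_{-k}(n) = N³ ĝ(k)`. -/
theorem sum_mul_chi_neg (g : (Fin 3 → ZMod N) → ℂ) (k : Fin 3 → ℤ) :
    ∑ n : Fin 3 → ZMod N, g n * chi (-modN N k) n = (N : ℂ) ^ 3 * coef N g k := by
  unfold coef
  rw [mul_comm, div_mul_cancel₀ _ natCast_pow_three_ne_zero]

/-- `Σ_n conj χ_k(n) χ_l(n) = N³ [l - k = 0]`. [folklore] -/
theorem sum_conj_chi_mul_chi (k l : Fin 3 → ZMod N) :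
    ∑ n : Fin 3 → ZMod N, conj (chi k n) * chi l n = if l - k = 0 then (N : ℂ) ^ 3 else 0 := by
  have e : ∀ n : Fin 3 → ZMod N, conj (chi k n) * chi l n = chi (l - k) n := fun n => by
    rw [conj_chi, sub_eq_add_neg, chi_add, mul_comm]
  simp_rw [e]
  exact sum_chi (l - k)

omit [NeZero N] in
/-- Modes of the cubic mask `|k_i| ≤ K` are distinct modulo `N` when `2K < N`. [folklore] -/
theorem modN_inj_of_box {K : ℕ} (hK : 2 * K < N) {k l : Fin 3 → ℤ} (hk : k ∈ Dealiasing.box K) (hl : l ∈ Dealiasing.box K)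
    (h : modN N k = modN N l) : k = l := by
  have h0 : modN N (k - l) = 0 := by rw [modN_sub, h, sub_self]
  have hv : ∀ i, |(k - l) i| < N := by
    intro i
    have h1 := mem_box.mp hk i
    have h2 := mem_box.mp hl i
    have hN : ((2 * K : ℕ) : ℤ) < (N : ℤ) := by exact_mod_cast hK
    simp only [Pi.sub_apply]
    rw [abs_le] at h1 h2
    rw [abs_lt]
    push_cast at hN
    omega
  exact sub_eq_zero.mp ((modN_eq_zero_iff hv).mp h0)

/-- **Bessel on the grid.** For a finite set `O` of integer modes distinct modulo `N` and any grid function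
`g`: `N³ Σ_{k∈O} |ĝ(k)|² ≤ Σ_n |g(n)|²`. [folklore] -/
theorem grid_bessel (g : (Fin 3 → ZMod N) → ℂ) (O : Finset (Fin 3 → ℤ))
    (hO : ∀ k ∈ O, ∀ l ∈ O, modN N k = modN N l → k = l) :
    (N : ℝ) ^ 3 * ∑ k ∈ O, ‖coef N g k‖ ^ 2 ≤ ∑ n : Fin 3 → ZMod N, ‖g n‖ ^ 2 := by
  set c : (Fin 3 → ℤ) → ℂ := fun k => coef N g k with hc
  set s : (Fin 3 → ZMod N) → ℂ := fun n => ∑ k ∈ O, c k * chi (modN N k) n with hs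
  -- (A) `Σ_n conj g · s = N³ Σ_k c_k conj c_k`
  have hconjsum : ∀ k : Fin 3 → ℤ, ∑ n : Fin 3 → ZMod N, conj (g n) * chi (modN N k) n =
      conj ((N : ℂ) ^ 3 * c k) := by
    intro k
    rw [hc]
    dsimp only
    rw [← sum_mul_chi_neg g k, map_sum]
    refine Finset.sum_congr rfl fun n _ => ?_
    rw [map_mul, conj_chi, neg_neg]
  have hA : ∑ n : Fin 3 → ZMod N, conj (g n) * s n = (N : ℂ) ^ 3 * ∑ k ∈ O, c k * conj (c k) := by
    calc ∑ n : Fin 3 → ZMod N, conj (g n) * s n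
        = ∑ n : Fin 3 → ZMod N, ∑ k ∈ O, c k * (conj (g n) * chi (modN N k) n) := by
          refine Finset.sum_congr rfl fun n _ => ?_
          rw [hs]
          dsimp only
          rw [Finset.mul_sum]
          exact Finset.sum_congr rfl fun k _ => by ring
      _ = ∑ k ∈ O, c k * ∑ n : Fin 3 → ZMod N, conj (g n) * chi (modN N k) n := by
          rw [Finset.sum_comm]
          exact Finset.sum_congr rfl fun k _ => by rw [Finset.mul_sum]
      _ = ∑ k ∈ O, c k * conj ((N : ℂ) ^ 3 * c k) := Finset.sum_congr rfl fun k _ => by rw [hconjsum]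
      _ = (N : ℂ) ^ 3 * ∑ k ∈ O, c k * conj (c k) := by
          rw [Finset.mul_sum]
          refine Finset.sum_congr rfl fun k _ => ?_
          rw [map_mul, map_pow, Complex.conj_natCast]
          ring
  -- (B) `Σ_n conj s · g = N³ Σ_k conj c_k c_k`
  have hB : ∑ n : Fin 3 → ZMod N, conj (s n) * g n = (N : ℂ) ^ 3 * ∑ k ∈ O, conj (c k) * c k := by
    calc ∑ n : Fin 3 → ZMod N, conj (s n) * g n
        = ∑ n : Fin 3 → ZMod N, ∑ k ∈ O, conj (c k) * (g n * chi (-modN N k) n) := by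
          refine Finset.sum_congr rfl fun n _ => ?_
          rw [hs]
          dsimp only
          rw [map_sum, Finset.sum_mul]
          refine Finset.sum_congr rfl fun k _ => ?_
          rw [map_mul, conj_chi]
          ring
      _ = ∑ k ∈ O, conj (c k) * ∑ n : Fin 3 → ZMod N, g n * chi (-modN N k) n := by
          rw [Finset.sum_comm]
          exact Finset.sum_congr rfl fun k _ => by rw [Finset.mul_sum]
      _ = (N : ℂ) ^ 3 * ∑ k ∈ O, conj (c k) * c k := by
          rw [Finset.mul_sum]
          refine Finset.sum_congr rfl fun k _ => ?_
          rw [sum_mul_chi_neg]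
          ring
  -- (C) `Σ_n conj s · s = N³ Σ_k conj c_k c_k` (orthogonality + injectivity mod N)
  have hC : ∑ n : Fin 3 → ZMod N, conj (s n) * s n = (N : ℂ) ^ 3 * ∑ k ∈ O, conj (c k) * c k := by
    calc ∑ n : Fin 3 → ZMod N, conj (s n) * s n
        = ∑ n : Fin 3 → ZMod N, ∑ k ∈ O, ∑ l ∈ O,
            conj (c k) * c l * (conj (chi (modN N k) n) * chi (modN N l) n) := by
          refine Finset.sum_congr rfl fun n _ => ?_
          rw [hs]
          dsimp only
          rw [map_sum, Finset.sum_mul_sum]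
          refine Finset.sum_congr rfl fun k _ => Finset.sum_congr rfl fun l _ => ?_
          rw [map_mul]
          ring
      _ = ∑ k ∈ O, ∑ l ∈ O, conj (c k) * c l *
            ∑ n : Fin 3 → ZMod N, conj (chi (modN N k) n) * chi (modN N l) n := by
          rw [Finset.sum_comm]
          refine Finset.sum_congr rfl fun k _ => ?_
          rw [Finset.sum_comm]
          exact Finset.sum_congr rfl fun l _ => by rw [Finset.mul_sum]
      _ = ∑ k ∈ O, ∑ l ∈ O, if l = k then conj (c k) * c l * (N : ℂ) ^ 3 else 0 := by
          refine Finset.sum_congr rfl fun k hk => Finset.sum_congr rfl fun l hl => ?_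
          rw [sum_conj_chi_mul_chi]
          by_cases hlk : l = k
          · subst hlk
            simp
          · have hne : ¬ modN N l - modN N k = 0 := fun h0 => hlk (hO l hl k hk (sub_eq_zero.mp h0))
            rw [if_neg hne, if_neg hlk, mul_zero]
      _ = (N : ℂ) ^ 3 * ∑ k ∈ O, conj (c k) * c k := by
          rw [Finset.mul_sum]
          refine Finset.sum_congr rfl fun k hk => ?_
          rw [Finset.sum_ite_eq' O k, if_pos hk]
          ring
  -- the residual identity `Σ |g - s|² = Σ |g|² - N³ Σ |c|²`
  have hres : ∑ n : Fin 3 → ZMod N, conj (g n - s n) * (g n - s n) =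
      ∑ n : Fin 3 → ZMod N, conj (g n) * g n - (N : ℂ) ^ 3 * ∑ k ∈ O, conj (c k) * c k := by
    have e : ∀ n : Fin 3 → ZMod N, conj (g n - s n) * (g n - s n) =
        conj (g n) * g n - conj (g n) * s n - conj (s n) * g n + conj (s n) * s n := fun n => by
      rw [map_sub]; ring
    simp_rw [e]
    rw [Finset.sum_add_distrib, Finset.sum_sub_distrib, Finset.sum_sub_distrib, hA, hB, hC]
    have hcomm : ∑ k ∈ O, c k * conj (c k) = ∑ k ∈ O, conj (c k) * c k :=
      Finset.sum_congr rfl fun k _ => mul_comm _ _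
    rw [hcomm]
    ring
  -- real parts
  have hG : ∑ n : Fin 3 → ZMod N, conj (g n) * g n = ((∑ n : Fin 3 → ZMod N, ‖g n‖ ^ 2 : ℝ) : ℂ) := by
    push_cast
    exact Finset.sum_congr rfl fun n _ => Complex.conj_mul' _
  have hR : ∑ n : Fin 3 → ZMod N, conj (g n - s n) * (g n - s n) =
      ((∑ n : Fin 3 → ZMod N, ‖g n - s n‖ ^ 2 : ℝ) : ℂ) := by
    push_cast
    exact Finset.sum_congr rfl fun n _ => Complex.conj_mul' _
  have hcc : ∑ k ∈ O, conj (c k) * c k = ((∑ k ∈ O, ‖c k‖ ^ 2 : ℝ) : ℂ) := by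
    push_cast
    exact Finset.sum_congr rfl fun k _ => Complex.conj_mul' _
  rw [hG, hR, hcc] at hres
  have hreal : (∑ n : Fin 3 → ZMod N, ‖g n - s n‖ ^ 2) =
      (∑ n : Fin 3 → ZMod N, ‖g n‖ ^ 2) - (N : ℝ) ^ 3 * ∑ k ∈ O, ‖c k‖ ^ 2 := by
    exact_mod_cast hres
  have hnn : 0 ≤ ∑ n : Fin 3 → ZMod N, ‖g n - s n‖ ^ 2 := Finset.sum_nonneg fun n _ => by positivity
  linarith

/-- **Grid Parseval** for one synthesised field whose modes are distinct modulo `N`: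
`Σ_n |u(n)|² = N³ Σ_{k∈B} |a_k|²` — proved here as the `≥` half that Bessel gives for free plus the `≤`
half by the same residual computation with zero residual; we only need and state the consequence
`N³ Σ_{k∈B} |a_k|² ≤ Σ_n |synth a (n)|²` together with the exact equality. -/
theorem grid_parseval {K : ℕ} (hK : 2 * K < N) {B : Finset (Fin 3 → ℤ)} (hB : B ⊆ Dealiasing.box K)
    (a : (Fin 3 → ℤ) → ℂ) :
    ∑ n : Fin 3 → ZMod N, ‖synth B a n‖ ^ 2 = (N : ℝ) ^ 3 * ∑ k ∈ B, ‖a k‖ ^ 2 := by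
  -- expand `Σ_n conj(u) u` by orthogonality
  have hinj : ∀ k ∈ B, ∀ l ∈ B, modN N k = modN N l → k = l := fun k hk l hl h =>
    modN_inj_of_box hK (hB hk) (hB hl) h
  have hC : ∑ n : Fin 3 → ZMod N, conj (synth B a n) * synth B a n = (N : ℂ) ^ 3 * ∑ k ∈ B, conj (a k) * a k := by
    calc ∑ n : Fin 3 → ZMod N, conj (synth B a n) * synth B a n
        = ∑ n : Fin 3 → ZMod N, ∑ k ∈ B, ∑ l ∈ B,
            conj (a k) * a l * (conj (chi (modN N k) n) * chi (modN N l) n) := by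
          refine Finset.sum_congr rfl fun n _ => ?_
          unfold synth
          rw [map_sum, Finset.sum_mul_sum]
          refine Finset.sum_congr rfl fun k _ => Finset.sum_congr rfl fun l _ => ?_
          rw [map_mul]
          ring
      _ = ∑ k ∈ B, ∑ l ∈ B, conj (a k) * a l *
            ∑ n : Fin 3 → ZMod N, conj (chi (modN N k) n) * chi (modN N l) n := by
          rw [Finset.sum_comm]
          refine Finset.sum_congr rfl fun k _ => ?_
          rw [Finset.sum_comm]
          exact Finset.sum_congr rfl fun l _ => by rw [Finset.mul_sum]
      _ = ∑ k ∈ B, ∑ l ∈ B, if l = k then conj (a k) * a l * (N : ℂ) ^ 3 else 0 := by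
          refine Finset.sum_congr rfl fun k hk => Finset.sum_congr rfl fun l hl => ?_
          rw [sum_conj_chi_mul_chi]
          by_cases hlk : l = k
          · subst hlk
            simp
          · have hne : ¬ modN N l - modN N k = 0 := fun h0 => hlk (hinj l hl k hk (sub_eq_zero.mp h0))
            rw [if_neg hne, if_neg hlk, mul_zero]
      _ = (N : ℂ) ^ 3 * ∑ k ∈ B, conj (a k) * a k := by
          rw [Finset.mul_sum]
          refine Finset.sum_congr rfl fun k hk => ?_
          rw [Finset.sum_ite_eq' B k, if_pos hk]
          ring
  have hL : ∑ n : Fin 3 → ZMod N, conj (synth B a n) * synth B a n =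
      ((∑ n : Fin 3 → ZMod N, ‖synth B a n‖ ^ 2 : ℝ) : ℂ) := by
    push_cast
    exact Finset.sum_congr rfl fun n _ => Complex.conj_mul' _
  have hRt : ∑ k ∈ B, conj (a k) * a k = ((∑ k ∈ B, ‖a k‖ ^ 2 : ℝ) : ℂ) := by
    push_cast
    exact Finset.sum_congr rfl fun k _ => Complex.conj_mul' _
  rw [hL, hRt] at hC
  exact_mod_cast hC

end Grid

end Summit.NavierStokesRegularity.FluidComputer.LambCeiling.Galerkin
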